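import Literature.MathematicalPhysics.KineticTheory.InfiniteChainFlowLocality
import Literature.MathematicalPhysics.KineticTheory.SeveredChainEnergyBounds
import Summits.AtomisticToContinuum.FouriersLaw.Theorems.EmbeddedDrudeMourreAbelThermodynamicLimitFixedTimeOffsetMatchingSeveredLimit

/-!
# Stub (B′|E1,M1sev) `stub_uniformFixedTimeOffsetMatchingOfEngines`, part 1: the severed flows of the GROWING BOND
WINDOWS `[x-n, x+1+n]` recover the infinite dynamics under the witness state
(crux `LatticeLandauDamping.AbelThermodynamicLimit`, item stmt-AtomisticToContinuum-14013, line
`series-law-at-every-laplace-frequency` (SketchIdeator2); `--supports` helper file, closes nothing)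

The dynamical engine (M1sev) `stub_openChainSeveredLocality` of the coupling stub compares the open chain with LLL's
severed flow of the window `Λ = [k-M, k+1+M]` of the bond `(k, k+1)` — an interval with an EVEN number of sites, which
is NOT one of Buttà–Marchioro's centred boxes `Λ_{μ,n} = [μ-n, μ+n]` (the only boxes for which the tree knows that the
severed orbits converge to the infinite-volume flow, `exists_bmDynamics` / `tendsto_severedFlow_flow`). This file closes
that gap:

* §1 energy-format bounds (in the format of `OscillatorChain.df_iterate_energy`) for the severed flow of the bond window
  `[x-n, x+1+n]`, relative to the centred box `Λ_{x,n+1}` (conservation of the severed energy of a GENERAL finite `Λ`,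
  `SeveredChainEnergyBounds`; the window energy is dominated by `W_{x,n+2}`);
* §2 `tendsto_severedFlow_bondWindow`: on `𝒳₀ = bmGood` the severed orbits of the bond windows converge coordinatewise,
  at the sites `x-1, x, x+1`, to the same limit as those of the centred boxes (second-order Dobrushin–Fritz iteration
  `df_iterate_energy` between `T^{[x-n,x+1+n]}` and `T^{Λ_{x,n}}` — both solve the equations on `Λ_{x,n}` from the same
  data, the discrepancy enters through the single extra moving site `x+1+n` — with BM's summability arithmetic
  `bm_arith`: the gap at depth `n` is `O(64^{-n})` in position and `O(n 64^{-n})` in momentum);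
* §3 `tendsto_integral_clamp_bondCurrentZ_severedFlow_bondWindow`: for a dynamics `D` with `D.carrier ⊆ bmGood`
  preserving `μT`, `∫ h_A(j_0) h_B(j_x ∘ T^{[x-n,x+1+n]}_t) dμT → ∫ h_A(j_0) h_B(j_x ∘ φ_t) dμT` (`n → ∞`) for the clamps
  `h_A`, `h_B` (dominated convergence; on the carrier `D.flow` is the Buttà–Marchioro flow by the `unique` field) —
  adapted from the sibling line's `tendsto_integral_clamp_bondCurrentZ_severedFlow` (centred boxes); registered closed form
  `pinnedChain_severedBondWindow_tendsto_flow`.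

All statements proved; `[folklore]`. No definitions.
-/

noncomputable section

namespace Summit.AtomisticToContinuum.FouriersLaw.Theorems.AbelThermodynamicLimit.SeriesLawAtEveryLaplaceFrequency

open MeasureTheory Set Filter Topology Function
open Literature.MathematicalPhysics.KineticTheory Literature.MathematicalPhysics.KineticTheory.HeatConduction
open OscillatorChain
open Literature.Analysis.FunctionSpaces (abs_max_neg_min_le)
open Summit.AtomisticToContinuum.FouriersLaw.Theorems.AbelThermodynamicLimit.LoomisCompactHorizonWitness (continuous_clamp)

namespace OffsetMatching

variable {P : OscillatorChain} {s₁ s₂ : ℕ}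

/-! ### §1 Energy-format bounds for the severed flow of a bond window -/

/-- The bond window `[x-n, x+1+n]` lies in the centred box `Λ_{x,n+1}`. [folklore] -/
theorem bondWindow_subset_cbox (x : ℤ) (n : ℕ) :
    Finset.Icc (x - n) (x + 1 + n) ⊆ Finset.Icc (x - (n + 1 : ℕ)) (x + (n + 1 : ℕ)) := by
  intro i hi
  rw [Finset.mem_Icc] at hi ⊢
  push_cast
  omega

/-- The centred box `Λ_{x,n}` lies in the bond window `[x-n, x+1+n]`. [folklore] -/
theorem cbox_subset_bondWindow (x : ℤ) (n : ℕ) :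
    Finset.Icc (x - n) (x + n) ⊆ Finset.Icc (x - n) (x + 1 + n) := by
  intro i hi
  rw [Finset.mem_Icc] at hi ⊢
  omega

/-- The severed energy of the bond window `[x-n, x+1+n]` is dominated by `W_{x,n+2}`. [folklore] -/
theorem sevEnergy_bondWindow_le (hU : IsEvenPolyOfDegree P.U s₁) (hV : IsEvenPolyOfDegree P.V s₂)
    (x : ℤ) (n : ℕ) (σ : ChainConfig) :
    sevEnergy P (Finset.Icc (x - n) (x + 1 + n)) σ 0 0
        (fun i : ↥(Finset.Icc (x - n) (x + 1 + n)) => σ i) ≤ P.bmLocalEnergy x (n + 2) σ := by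
  refine (sevEnergy_restrict_mono hU hV (bondWindow_subset_cbox x n) σ).trans ?_
  rw [sevEnergy_restrict]
  exact sevEnergy_le_bmLocalEnergy_succ hU.nonneg hV.nonneg x (n + 1) σ

/-- **Energy-format bounds for the severed flow of the bond window** `Λ = [x-n, x+1+n]`, relative to the centred box
`Λ_{x,n+1} ⊇ Λ` and in the format of `OscillatorChain.df_iterate_energy`: if `W_{x,n+2}(σ) ≤ Y` then along
`T^Λ_s σ` the pinning energies on `Λ_{x,n+1}` and the bond energies on the bonds `[x-n-1, x+n]` are `≤ Y`, and the
displacements on `Λ_{x,n+1}` are `≤ |s| (2Y)^{1/2}` (conservation of the severed energy of `Λ`; the one site of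
`Λ_{x,n+1}` outside `Λ` is frozen). [folklore] -/
theorem bondWindow_energy_format (hU : IsEvenPolyOfDegree P.U s₁) (hV : IsEvenPolyOfDegree P.V s₂)
    (x : ℤ) (n : ℕ) (σ : ChainConfig) {Y : ℝ} (hY : P.bmLocalEnergy x (n + 2) σ ≤ Y) (s : ℝ) :
    (∀ j ∈ Finset.Icc (x - (n + 1 : ℕ)) (x + (n + 1 : ℕ)),
      P.U (severedFlow (condB1_of_isEvenPolyOfDegree hU hV) (Finset.Icc (x - n) (x + 1 + n)) s σ j).1 ≤ Y) ∧
    (∀ j ∈ Finset.Icc (x - n - 1) (x + n),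
      P.V ((severedFlow (condB1_of_isEvenPolyOfDegree hU hV) (Finset.Icc (x - n) (x + 1 + n)) s σ (j + 1)).1 -
        (severedFlow (condB1_of_isEvenPolyOfDegree hU hV) (Finset.Icc (x - n) (x + 1 + n)) s σ j).1) ≤ Y) ∧
    (∀ j ∈ Finset.Icc (x - (n + 1 : ℕ)) (x + (n + 1 : ℕ)),
      |(severedFlow (condB1_of_isEvenPolyOfDegree hU hV) (Finset.Icc (x - n) (x + 1 + n)) s σ j).1 - (σ j).1| ≤
        |s| * Real.sqrt (2 * Y)) := by
  set hB1 := condB1_of_isEvenPolyOfDegree hU hV with hB1def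
  set Λ : Finset ℤ := Finset.Icc (x - n) (x + 1 + n) with hΛ
  set H : ℝ := sevEnergy P Λ σ 0 0 (fun i : ↥Λ => σ i) with hH
  have hHY : H ≤ Y := (sevEnergy_bondWindow_le hU hV x n σ).trans hY
  have hH0 : 0 ≤ H := sevEnergy_restrict_nonneg hU hV Λ σ
  have hW1 : P.bmLocalEnergy x (n + 1) σ ≤ Y :=
    (bmLocalEnergy_mono hU.nonneg hV.nonneg x (Nat.le_succ (n + 1)) σ).trans hY
  refine ⟨fun j hj => ?_, fun j hj => ?_, fun j hj => ?_⟩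
  · by_cases hjΛ : j ∈ Λ
    · exact (apply_U_severedFlow_le hU hV Λ σ hjΛ s).trans hHY
    · rw [severedFlow_apply_of_not_mem hB1 Λ s σ hjΛ]
      have h := site_le_bmLocalEnergy hU.nonneg hV.nonneg σ hj
      nlinarith [sq_nonneg (σ j).2]
  · have hjb : j ∈ Λ ∨ j + 1 ∈ Λ := by
      rw [Finset.mem_Icc] at hj
      by_cases h : x - n ≤ j
      · left; rw [hΛ, Finset.mem_Icc]; omega
      · right; rw [hΛ, Finset.mem_Icc]; omega
    exact (apply_V_severedFlow_le hU hV Λ σ hjb s).trans hHY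
  · calc |(severedFlow hB1 Λ s σ j).1 - (σ j).1| ≤ |s| * Real.sqrt (2 * H) :=
          abs_fst_severedFlow_sub_le hU hV Λ σ j s
      _ ≤ |s| * Real.sqrt (2 * Y) := by gcongr

/-! ### §2 The severed orbits of the bond windows converge to the infinite-volume flow on `𝒳₀` -/

/-- **The severed flows of the bond windows have the same limit as those of the centred boxes.** Let `U`, `V` be
even non-negative polynomials of degrees `2s₁, 2s₂ ≥ 2` and suppose the severed orbits of the centred boxes `Λ_{μ,n}`
converge coordinatewise on `𝒳₀` to `Φ` (true for the Buttà–Marchioro flow, `exists_bmDynamics`). Then for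
`σ ∈ 𝒳₀`, every `s` and every site `i ∈ {x-1, x, x+1}`, `T^{[x-n, x+1+n]}_s σ (i) → Φ_s σ (i)` as `n → ∞`: the
window flow and `T^{Λ_{x,n}}` both solve the equations of motion on `Λ_{x,n}` from `σ`, their energies there are
controlled by `W_{x,n+2}(σ) ≤ Q(σ)(2n + 2log(e+|x|) + 7)`, so the Dobrushin–Fritz iteration `df_iterate_energy` with
BM's arithmetic `bm_arith` bounds their gap at depth `n` by `64^{-n}` (positions) and `2n·64^{-n}/|s|` (momenta).
[folklore] -/
theorem tendsto_severedFlow_bondWindow (hs₁ : 1 ≤ s₁) (hs₂ : 1 ≤ s₂) (hU1 : IsEvenPolyOfDegree P.U s₁)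
    (hV1 : IsEvenPolyOfDegree P.V s₂) (hB1 : P.CondB1) {Φ : ℝ → ChainConfig → ChainConfig}
    (hΦ : ∀ σ ∈ P.bmGood, ∀ (s : ℝ) (μ i : ℤ),
      Tendsto (fun n : ℕ => severedFlow hB1 (Finset.Icc (μ - n) (μ + n)) s σ i) atTop (𝓝 (Φ s σ i)))
    {σ : ChainConfig} (hσ : σ ∈ P.bmGood) (x : ℤ) (s : ℝ) {i : ℤ}
    (hi : i ∈ Finset.Icc (x - (1 : ℕ)) (x + (1 : ℕ))) :
    Tendsto (fun n : ℕ => severedFlow hB1 (Finset.Icc (x - n) (x + 1 + n)) s σ i) atTop (𝓝 (Φ s σ i)) := by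
  -- adapted from `OscillatorChain.tendsto_severedFlow_cbox` (centred boxes with two centres there, bond window here)
  have ehB1 : hB1 = condB1_of_isEvenPolyOfDegree hU1 hV1 := rfl
  by_cases hs0 : s = 0
  · subst hs0
    have h := hΦ σ hσ 0 x i
    simp only [severedFlow_zero] at h ⊢
    exact h
  have hU : ContDiff ℝ 2 P.U := hU1.contDiff_two
  have hV : ContDiff ℝ 2 P.V := hV1.contDiff_two
  have hU0 : ∀ r, 0 ≤ P.U r := hU1.nonneg
  have hV0 : ∀ r, 0 ≤ P.V r := hV1.nonneg
  have hVe : ∀ r, P.V (-r) = P.V r := fun r => congrFun hV1.comp_neg r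
  obtain ⟨K₁, K₂, hK₁0, hK₂1, hLipF, -, -, -, -⟩ := exists_constants hs₁ hs₂ hU1 hV1
  set η : ℝ := (((max s₁ s₂ : ℕ) : ℝ) - 1) / ((max s₁ s₂ : ℕ) : ℝ) with hη
  have hS1 : (1 : ℝ) ≤ ((max s₁ s₂ : ℕ) : ℝ) := by exact_mod_cast le_max_of_le_left hs₁
  have hS0 : (0 : ℝ) < ((max s₁ s₂ : ℕ) : ℝ) := by linarith
  have hη1 : η ≤ 1 := by rw [hη, div_le_one hS0]; linarith
  have hη0 : 0 ≤ η := by rw [hη]; exact div_nonneg (by linarith) hS0.le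
  set γ₀ : ℝ := (η + 2) / 2 with hγ₀
  have hγ : η < γ₀ := by rw [hγ₀]; linarith
  have hγ2 : γ₀ < 2 := by rw [hγ₀]; linarith
  obtain ⟨A, hA1, hA⟩ := bm_arith hK₁0 hη0 hγ hγ2 one_pos
  -- notation
  set Q := P.bmGrowth σ with hQ
  set L := Real.log (Real.exp 1 + |(x : ℝ)|) with hL
  have hQ1 : 1 ≤ Q := one_le_bmGrowth hU0 hV0 hσ
  have hQ0 : 0 ≤ Q := zero_le_one.trans hQ1
  have hL1 : 1 ≤ L := one_le_log_exp_add_abs x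
  set L' : ℝ := L + 1 with hL'
  have hL'1 : 1 ≤ L' := by rw [hL']; linarith
  set t : ℝ := |s| with ht
  have ht0 : 0 < t := abs_pos.2 hs0
  set X := (1 + t ^ 2 * (1 + t ^ (1 : ℝ)) * Q ^ γ₀) ^ (1 / (2 - γ₀)) with hX
  have hX0 : 0 ≤ X := by rw [hX]; exact Real.rpow_nonneg (by positivity) _
  have hAXL : 0 ≤ A * X * L' := by
    have : 0 ≤ A := zero_le_one.trans hA1
    have : 0 ≤ L' := zero_le_one.trans hL'1
    positivity
  set n₁ : ℕ := ⌈A * X * L'⌉₊ + 1 with hn₁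
  -- the two flows to compare, at stage `n`
  set T₀ : ℕ → ℝ × ℝ := fun n => severedFlow hB1 (Finset.Icc (x - n) (x + n)) s σ i with hT₀
  set Ta : ℕ → ℝ × ℝ := fun n => severedFlow hB1 (Finset.Icc (x - n) (x + 1 + n)) s σ i with hTa
  -- the main estimate
  have hmain : ∀ n : ℕ, n₁ ≤ n →
      ‖Ta n - T₀ n‖ ≤ (1 + 2 / t) * ((1 / 64) ^ (n - 0) + ((n - 0 : ℕ) : ℝ) * (1 / 64) ^ (n - 0)) := by
    intro n hn
    have hd1 : 1 ≤ n := le_trans (Nat.le_add_left 1 _) hn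
    have hceil : A * X * L' ≤ (⌈A * X * L'⌉₊ : ℝ) := Nat.le_ceil _
    have hdn : A * X * L' ≤ ((n : ℕ) : ℝ) := by
      have h1 : ((⌈A * X * L'⌉₊ + 1 : ℕ) : ℝ) ≤ n := by exact_mod_cast hn
      push_cast at h1
      linarith
    have hkd : 1 + n = n + 1 := by omega
    -- the energy level
    set Y : ℝ := P.bmLocalEnergy x (n + 2) σ with hY
    have hY1 : 1 ≤ Y := one_le_bmLocalEnergy hU0 hV0 x _ σ
    have hYa : P.bmLocalEnergy x (n + 2) σ ≤ Y := le_rfl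
    have hY0 : P.bmLocalEnergy x (n + 1) σ ≤ Y :=
      bmLocalEnergy_mono hU0 hV0 x (Nat.le_succ (n + 1)) σ
    have hYle : Y ≤ 18 * Q * (n + L') := by
      have h0 := bmLocalEnergy_le hU0 hV0 hσ x (n + 2)
      rw [← hQ, ← hL] at h0
      push_cast at h0
      have hn0 : (0 : ℝ) ≤ n := Nat.cast_nonneg n
      have h1 : Q * (2 * ((n : ℝ) + 2) + 2 * L + 3) ≤ Q * (18 * (n + L')) := by
        refine mul_le_mul_of_nonneg_left ?_ hQ0
        rw [hL']; linarith
      rw [hY]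
      linarith
    -- energy-format bounds for both flows
    have hsola := isSeveredSolution_severedFlow hB1 (Finset.Icc (x - n) (x + 1 + n)) σ
    have hsol₀ := isSeveredSolution_severedFlow hB1 (Finset.Icc (x - n) (x + n)) σ
    have hfa := fun r => bondWindow_energy_format hU1 hV1 x n σ hYa r
    rw [← ehB1] at hfa
    have key := df_iterate_energy (K₁ := K₁) (η := η) hLipF (x := σ) (μ := x) (n := n) (t := t) hY1
      (γ₁ := fun r => severedFlow hB1 (Finset.Icc (x - n) (x + 1 + n)) r σ)
      (γ₂ := fun r => severedFlow hB1 (Finset.Icc (x - n) (x + n)) r σ)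
      (fun j hj r => hsola.1 j (cbox_subset_bondWindow x n hj) r)
      (fun j hj r => hsol₀.1 j hj r)
      (fun j _ => by simp) (fun j _ => by simp)
      (fun r hr j hj => (hfa r).1 j hj)
      (fun r hr j hj => (severedFlow_energy_format hU hV hU0 hV0 hVe hB1 x n σ hY0 r).1 j hj)
      (fun r hr j hj => (hfa r).2.1 j hj)
      (fun r hr j hj => (severedFlow_energy_format hU hV hU0 hV0 hVe hB1 x n σ hY0 r).2.1 j hj)
      (fun r hr j hj => by
        calc |(severedFlow hB1 (Finset.Icc (x - n) (x + 1 + n)) r σ j).1 - (σ j).1|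
            ≤ |r| * Real.sqrt (2 * Y) := (hfa r).2.2 j hj
          _ ≤ t * Real.sqrt (2 * Y) := mul_le_mul_of_nonneg_right hr (Real.sqrt_nonneg _))
      (fun r hr j hj => by
        have hf := (severedFlow_energy_format hU hV hU0 hV0 hVe hB1 x n σ hY0 r).2.2.1
        calc |(severedFlow hB1 (Finset.Icc (x - n) (x + n)) r σ j).1 - (σ j).1|
            ≤ |r| * Real.sqrt (2 * Y) := hf j hj
          _ ≤ t * Real.sqrt (2 * Y) := mul_le_mul_of_nonneg_right hr (Real.sqrt_nonneg _))
      n 1 hkd i hi s le_rfl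
    obtain ⟨hq, hp⟩ := key
    have hp := hp hd1
    -- the arithmetic
    have harith := hA Q L' t Y n hQ1 hL'1 ht0.le hY1 hYle hdn
    have hq' : |(severedFlow hB1 (Finset.Icc (x - n) (x + 1 + n)) s σ i).1 -
        (severedFlow hB1 (Finset.Icc (x - n) (x + n)) s σ i).1| ≤ (1 / 64) ^ n := hq.trans harith
    have hp' : |(severedFlow hB1 (Finset.Icc (x - n) (x + 1 + n)) s σ i).2 -
        (severedFlow hB1 (Finset.Icc (x - n) (x + n)) s σ i).2| ≤ (1 / 64) ^ n * (2 * n) / |s| :=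
      hp.trans (iter_p_bound_of_q_bound hd1 hs0 harith)
    -- conversion to the stated majorant
    simp only [Nat.sub_zero]
    have hpos : (0 : ℝ) ≤ (1 / 64) ^ n := by positivity
    have hn0 : (0 : ℝ) ≤ (n : ℝ) := Nat.cast_nonneg _
    set S : ℝ := (1 / 64) ^ n + (n : ℝ) * (1 / 64) ^ n with hS
    have hSnn : 0 ≤ S := by rw [hS]; positivity
    have h2t : 0 ≤ 2 / t := by positivity
    rw [Prod.norm_def, Real.norm_eq_abs, Real.norm_eq_abs]
    refine max_le ?_ ?_
    · calc |(Ta n).1 - (T₀ n).1| ≤ (1 / 64) ^ n := hq'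
        _ ≤ S := by rw [hS]; exact le_add_of_nonneg_right (by positivity)
        _ = 1 * S := (one_mul S).symm
        _ ≤ (1 + 2 / t) * S := mul_le_mul_of_nonneg_right (by linarith) hSnn
    · calc |(Ta n).2 - (T₀ n).2| ≤ (1 / 64) ^ n * (2 * n) / |s| := hp'
        _ = (2 / t) * ((n : ℝ) * (1 / 64) ^ n) := by rw [ht]; field_simp
        _ ≤ (2 / t) * S := by
            refine mul_le_mul_of_nonneg_left ?_ h2t
            rw [hS]; exact le_add_of_nonneg_left hpos
        _ ≤ (1 + 2 / t) * S := mul_le_mul_of_nonneg_right (by linarith) hSnn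
  -- conclusion
  have hdiff : Tendsto (fun n => Ta n - T₀ n) atTop (𝓝 0) := by
    refine squeeze_zero_norm' ?_ (tendsto_geom_aux (1 + 2 / t) 0)
    exact eventually_atTop.2 ⟨n₁, hmain⟩
  have hT₀ : Tendsto T₀ atTop (𝓝 (Φ s σ i)) := hΦ σ hσ s x i
  have h := hdiff.add hT₀
  rw [zero_add] at h
  have he : (fun n => Ta n - T₀ n + T₀ n) = Ta := by funext n; simp
  rwa [he] at h

/-! ### §3 The severed flows of the growing bond windows recover the infinite dynamics under the witness state -/

section SeveredLimit

variable {ω₂ lam β γ : ℝ} (hω : 0 < ω₂) (hl : 0 < lam) (hβ : 0 < β)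

include hω hl hβ in
/-- **Severed bond windows → infinite dynamics under the witness state.** For `D.carrier ⊆ bmGood` and `D`
preserving `μT`, `∫ h_A(j_0) h_B(j_x ∘ T^{[x-n, x+1+n]}_t) dμT → ∫ h_A(j_0) h_B(j_x ∘ φ_t) dμT` as `n → ∞`
(`h_C = max(-C, min(C, ·))` the clamp, `T^Λ_t` LLL's severed flow): on the carrier the severed orbits of the bond windows
converge coordinatewise at the sites `x, x+1` to the Buttà–Marchioro flow (`tendsto_severedFlow_bondWindow` with
`exists_bmDynamics`), which is `D.flow` there by the `unique` field; dominated convergence. [folklore] -/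
theorem tendsto_integral_clamp_bondCurrentZ_severedFlow_bondWindow
    (hB1 : (pinnedChain ω₂ lam β γ).CondB1) {μT : Measure ChainConfig} [IsProbabilityMeasure μT]
    (D : InfiniteChainDynamics (pinnedChain ω₂ lam β γ)) (hcar : D.carrier ⊆ (pinnedChain ω₂ lam β γ).bmGood)
    (hPres : D.PreservesMeasure μT) (t : ℝ) (x : ℤ) {A B : ℝ} (hA : 0 ≤ A) (hB : 0 ≤ B) :
    Tendsto (fun n : ℕ => ∫ σ, max (-A) (min A ((pinnedChain ω₂ lam β γ).bondCurrentZ σ 0)) *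
        max (-B) (min B ((pinnedChain ω₂ lam β γ).bondCurrentZ
          (severedFlow hB1 (Finset.Icc (x - n) (x + 1 + n)) t σ) x)) ∂μT) atTop
      (𝓝 (∫ σ, max (-A) (min A ((pinnedChain ω₂ lam β γ).bondCurrentZ σ 0)) *
        max (-B) (min B ((pinnedChain ω₂ lam β γ).bondCurrentZ (D.flow t σ) x)) ∂μT)) := by
  -- adapted from `LoomisCompactHorizonWitness.tendsto_integral_clamp_bondCurrentZ_severedFlow` (centred boxes there)
  have hU1 := pinnedChain_isEvenPolyOfDegree_U β γ hω.le hl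
  have hV1 := pinnedChain_isEvenPolyOfDegree_V ω₂ lam γ hβ
  have hU : ContDiff ℝ 2 (pinnedChain ω₂ lam β γ).U := hU1.contDiff_two
  have hV : ContDiff ℝ 2 (pinnedChain ω₂ lam β γ).V := hV1.contDiff_two
  obtain ⟨D₀, hD₀, -, -, -, hrep, -, -⟩ := exists_bmDynamics (P := pinnedChain ω₂ lam β γ) (s₁ := 2) (s₂ := 2)
    (by norm_num) (by norm_num) hU1 hV1
  have hcmA : Measurable fun r : ℝ => max (-A) (min A r) := (continuous_clamp A).measurable
  have hcmB : Measurable fun r : ℝ => max (-B) (min B r) := (continuous_clamp B).measurable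
  have hFm : ∀ n : ℕ, AEStronglyMeasurable (fun σ => max (-A) (min A ((pinnedChain ω₂ lam β γ).bondCurrentZ σ 0)) *
      max (-B) (min B ((pinnedChain ω₂ lam β γ).bondCurrentZ
        (severedFlow hB1 (Finset.Icc (x - n) (x + 1 + n)) t σ) x))) μT := fun n =>
    ((hcmA.comp (measurable_bondCurrentZ (pinnedChain ω₂ lam β γ) 0)).mul
      (hcmB.comp ((measurable_bondCurrentZ (pinnedChain ω₂ lam β γ) x).comp
        (measurable_severedFlow hB1 _ hU hV t)))).aestronglyMeasurable
  refine tendsto_integral_of_dominated_convergence (fun _ => A * B) hFm (integrable_const _)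
    (fun n => Eventually.of_forall fun σ => ?_) ?_
  · rw [Real.norm_eq_abs, abs_mul]
    exact mul_le_mul (abs_max_neg_min_le hA _) (abs_max_neg_min_le hB _) (abs_nonneg _) hA
  · filter_upwards [hPres.1] with σ hσ
    have hσg : σ ∈ (pinnedChain ω₂ lam β γ).bmGood := hcar hσ
    have hflow : D.flow t σ = D₀.flow t σ := by
      have h := D₀.unique (fun u => D.flow u σ) (fun u => hD₀.symm ▸ hcar (D.flow_mem hσ u)) (D.isSolution σ hσ) t
      simpa only [D.flow_zero σ hσ] using h
    have hcoord : ∀ i ∈ Finset.Icc (x - (1 : ℕ)) (x + (1 : ℕ)),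
        Tendsto (fun n : ℕ => severedFlow hB1 (Finset.Icc (x - n) (x + 1 + n)) t σ i) atTop
          (𝓝 (D.flow t σ i)) := by
      intro i hi
      rw [hflow]
      exact tendsto_severedFlow_bondWindow (by norm_num) (by norm_num) hU1 hV1 hB1 (Φ := D₀.flow)
        (fun σ' hσ' s μ i' => hrep hB1 σ' hσ' s μ i') hσg x t hi
    have hg : Continuous fun u : (ℝ × ℝ) × (ℝ × ℝ) =>
        -((u.1.2 + u.2.2) / 2 * deriv (pinnedChain ω₂ lam β γ).V (u.2.1 - u.1.1)) := by
      have hdV : Continuous (deriv (pinnedChain ω₂ lam β γ).V) := hV.continuous_deriv (by norm_num)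
      fun_prop
    have hj : Tendsto (fun n : ℕ => (pinnedChain ω₂ lam β γ).bondCurrentZ
        (severedFlow hB1 (Finset.Icc (x - n) (x + 1 + n)) t σ) x) atTop
        (𝓝 ((pinnedChain ω₂ lam β γ).bondCurrentZ (D.flow t σ) x)) :=
      (hg.tendsto _).comp ((hcoord x (by rw [Finset.mem_Icc]; push_cast; omega)).prodMk_nhds
        (hcoord (x + 1) (by rw [Finset.mem_Icc]; push_cast; omega)))
    exact tendsto_const_nhds.mul (((continuous_clamp B).tendsto _).comp hj)

end SeveredLimit

end OffsetMatching

open OffsetMatching in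
/-- **Registered helper `pinnedChain_severedBondWindow_tendsto_flow`** (stub (B′|E1,M1sev) of line
`series-law-at-every-laplace-frequency`): the severed Hamiltonian flows of the growing BOND WINDOWS `[x-n, x+1+n]` recover the infinite
dynamics of a `bmGood`-carried witness under its invariant state, tested on the clamped current pairing (closed form of
`tendsto_integral_clamp_bondCurrentZ_severedFlow_bondWindow`; the bond-window twin of the sibling line's
`stub_severedToInfiniteDynamics`, which has the centred boxes `{-R,…,R}`). [folklore] -/
theorem pinnedChain_severedBondWindow_tendsto_flow :
    ∀ ω₂ lam β γ : ℝ, 0 < ω₂ → 0 < lam → 0 < β →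
      ∀ (hB1 : (Literature.MathematicalPhysics.KineticTheory.HeatConduction.pinnedChain ω₂ lam β γ).CondB1)
        (μT : MeasureTheory.Measure Literature.MathematicalPhysics.KineticTheory.HeatConduction.ChainConfig),
        MeasureTheory.IsProbabilityMeasure μT →
      ∀ (D : Literature.MathematicalPhysics.KineticTheory.HeatConduction.InfiniteChainDynamics
          (Literature.MathematicalPhysics.KineticTheory.HeatConduction.pinnedChain ω₂ lam β γ)),
        D.carrier ⊆ (Literature.MathematicalPhysics.KineticTheory.HeatConduction.pinnedChain ω₂ lam β γ).bmGood →
        D.PreservesMeasure μT →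
      ∀ (t : ℝ) (x : ℤ) (A B : ℝ), 0 ≤ A → 0 ≤ B →
        Filter.Tendsto (fun n : ℕ => ∫ σ,
            max (-A) (min A ((Literature.MathematicalPhysics.KineticTheory.HeatConduction.pinnedChain
              ω₂ lam β γ).bondCurrentZ σ 0)) *
            max (-B) (min B ((Literature.MathematicalPhysics.KineticTheory.HeatConduction.pinnedChain
              ω₂ lam β γ).bondCurrentZ
                (Literature.MathematicalPhysics.KineticTheory.HeatConduction.OscillatorChain.severedFlow hB1
                  (Finset.Icc (x - n) (x + 1 + n)) t σ) x)) ∂μT)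
          Filter.atTop
          (nhds (∫ σ,
            max (-A) (min A ((Literature.MathematicalPhysics.KineticTheory.HeatConduction.pinnedChain
              ω₂ lam β γ).bondCurrentZ σ 0)) *
            max (-B) (min B ((Literature.MathematicalPhysics.KineticTheory.HeatConduction.pinnedChain
              ω₂ lam β γ).bondCurrentZ (D.flow t σ) x)) ∂μT)) :=
  fun _ _ _ _ hω hl hβ hB1 _ _ D hcar hPres t x _ _ hA hB =>
    tendsto_integral_clamp_bondCurrentZ_severedFlow_bondWindow hω hl hβ hB1 D hcar hPres t x hA hB



end Summit.AtomisticToContinuum.FouriersLaw.Theorems.AbelThermodynamicLimit.SeriesLawAtEveryLaplaceFrequency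

end
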